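import Summits.HodgeConjecture.CorCM.AbelianCMFieldsStablyNondegenerate
import Summits.HodgeConjecture.CorCM.CyclotomicFieldsTwoPowerClassification
import Summits.HodgeConjecture.HodgeConjecture.Theorems.Ring2ClassTargets
import HarnessLib

/-!
# Cyclotomic fields: ALL abelian varieties with complex multiplication by `ℚ(ζ_N)` are stably nondegenerate iff
# (`m = 1` ∧ `φ(N) ≤ 8`) ∨ (`(ℤ/N)ˣ` cyclic ∧ `m ∈ {1} ∪ primes`), `φ(N) = 2^{a+1} m`

COR-CM (cell `pub-hodgecm2`), binder seat b04 (gen 21), count-neutral claim CYCLOTOMIC-ALLTYPES (blanket `Cyclotomic*`) —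
the all-types form of gen 18's COMPLETE CYCLOTOMIC LIST (`AbelianOddPart.forall_isSimple_isNondegenerate_iff_cyclotomic_all`:
every SIMPLE abelian variety with CM by `ℚ(ζ_N)` is nondegenerate ⟺ (`m = 1 ∧ φ(N) ≤ 8`) ∨ (`(ℤ/N)ˣ` cyclic ∧
(`m = 1 ∨ m` prime))), by gen 21 part VII (`AbelianAllTypes.forall_isStablyNondegenerate_iff_abelian`: for abelian CM
fields the simple classification is the all-X classification).  KERNEL ONLY: theorems; no definition, no named fact, no
`sorry`.  `HC_CM` is neither used nor claimed.

* **`forall_isStablyNondegenerate_iff_cyclotomic_all`** — the classification for ALL abelian varieties `X` with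
  `ℚ(ζ_N) ↪ End⁰(X)`, `φ(N) = 2 dim X`; `isStablyNondegenerate_of_cyclotomic_good`, `hodgeConjectureFor_pow_of_cyclotomic_good`
  (gen 18's `hodgeConjectureFor_pow_of_isSimple_cyclotomic` WITHOUT `A.IsSimple`), HCOnClass.
  Good conductors `N ≤ 100` (gen 18): `3, 4, 5, 7, 8, 9, 11, 12, 13, 15, 16, 17, 20, 23, 24, 25, 29, 41, 47, 53, 59, 83, 89, 97`.

## References

* [Kubota1965] T. Kubota, Trans. AMS 118 (1965), §4 Lemma 2.
* [Washington1997] L. C. Washington, *Introduction to Cyclotomic Fields*, Thm. 2.5.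
* [Gordon1999HodgeAVSurvey] B. B. Gordon, *A survey of the Hodge conjecture for abelian varieties*, 5.13, Thm. 6.4, §9.4.3.
* [Shimura1998] G. Shimura, *Abelian Varieties with Complex Multiplication and Modular Functions*, §5.1 Prop. 3, §8.2
  Prop. 26.
-/

noncomputable section

open CategoryTheory CategoryTheory.Limits NumberField

namespace Summit.HodgeConjecture.CorCM.CyclotomicAllTypes

open Literature.NumberTheory.ComplexMultiplication
open Literature.AlgebraicGeometry Literature.AlgebraicGeometry.Motives Literature.AlgebraicGeometry.HodgeTheory
open Literature.AlgebraicGeometry.Motives.AbelianVariety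
open Literature.AlgebraicGeometry.ComplexMultiplication
open Literature.AlgebraicGeometry.Pohlmann1968
open Summit.HodgeConjecture.HodgeConjecture.Ring2.ClassTargets
open Summit.HodgeConjecture.CorCM.AbelianOddPart (cyclotomic_data forall_isPrimitive_isNondegenerate_iff_abelian
  forall_isPrimitive_isNondegenerate_iff_cyclotomic_all)

variable {L : Type} [Field L] [NumberField L]

/-- **THE CYCLOTOMIC CLASSIFICATION FOR ALL ABELIAN VARIETIES.**  `L = ℚ(ζ_N)`, `N ≥ 3`, `φ(N) = 2^{a+1} m`, `m` odd:
EVERY complex abelian variety `X` with `φ : L →+* End⁰(X)` and `φ(N) = 2 dim X` is stably nondegenerate ⟺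
(`m = 1` ∧ `φ(N) ≤ 8`) ∨ (`(ℤ/N)ˣ` cyclic ∧ (`m = 1` ∨ `m` prime)) — the same list as for SIMPLE varieties (gen 18).
[cite: Kubota1965, §4 Lemma 2] [cite: Washington1997, Thm. 2.5] [cite: Gordon1999HodgeAVSurvey, Thm. 6.4 and §9.4.3] -/
theorem forall_isStablyNondegenerate_iff_cyclotomic_all {N a m : ℕ} (hN : 3 ≤ N) (hm : Odd m)
    (hφ : N.totient = 2 ^ (a + 1) * m) [IsCyclotomicExtension {N} ℚ L] :
    (∀ (X : AbelianVariety ℂ) (_ : L →+* X.endAlgebra), Module.finrank ℚ L = 2 * X.dim → IsStablyNondegenerate X) ↔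
      (m = 1 ∧ N.totient ≤ 8) ∨ (IsCyclic (ZMod N)ˣ ∧ (m = 1 ∨ m.Prime)) := by
  obtain ⟨hcm, hgal, hcomm, -, hL⟩ := cyclotomic_data hN L
  haveI := hcm
  haveI := hgal
  obtain ⟨φ₀⟩ := (inferInstance : Nonempty (L →+* ℂ))
  rw [AbelianAllTypes.forall_isStablyNondegenerate_iff_abelian hcomm hm (hL.trans hφ),
    ← forall_isPrimitive_isNondegenerate_iff_abelian hcomm hm (hL.trans hφ) φ₀,
    forall_isPrimitive_isNondegenerate_iff_cyclotomic_all hN hm hφ φ₀]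

/-- **Good cyclotomic fields: every abelian variety with an `ℚ(ζ_N)`-action is stably nondegenerate.**
[cite: Gordon1999HodgeAVSurvey, Thm. 6.4 and §9.4.3] [cite: Kubota1965, §4 Lemma 2] -/
theorem isStablyNondegenerate_of_cyclotomic_good {N a m : ℕ} (hN : 3 ≤ N) (hm : Odd m)
    (hφ : N.totient = 2 ^ (a + 1) * m) [IsCyclotomicExtension {N} ℚ L]
    (hgood : (m = 1 ∧ N.totient ≤ 8) ∨ (IsCyclic (ZMod N)ˣ ∧ (m = 1 ∨ m.Prime)))
    {X : AbelianVariety ℂ} (φ : L →+* X.endAlgebra) (hX : Module.finrank ℚ L = 2 * X.dim) : IsStablyNondegenerate X :=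
  (forall_isStablyNondegenerate_iff_cyclotomic_all hN hm hφ).2 hgood X φ hX

/-- **The Hodge conjecture for everything isogenous to a power of such an `X`.** [cite: Gordon1999HodgeAVSurvey, Thm. 6.3–6.4]
[cite: vanGeemen1994HodgeAV, Lemma 3.7] -/
theorem hodgeConjectureFor_of_isIsogenous_powSucc_cyclotomic_good {N a m : ℕ} (hN : 3 ≤ N) (hm : Odd m)
    (hφ : N.totient = 2 ^ (a + 1) * m) [IsCyclotomicExtension {N} ℚ L]
    (hgood : (m = 1 ∧ N.totient ≤ 8) ∨ (IsCyclic (ZMod N)ˣ ∧ (m = 1 ∨ m.Prime)))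
    {X : AbelianVariety ℂ} (φ : L →+* X.endAlgebra) (hX : Module.finrank ℚ L = 2 * X.dim) {B : AbelianVariety ℂ}
    {M : ℕ} (h : IsIsogenous B (X.powSucc M)) : HodgeConjectureFor B.dim B.X :=
  (isStablyNondegenerate_of_cyclotomic_good hN hm hφ hgood φ hX).hodgeConjectureFor_of_isIsogenous_powSucc h

variable {Φ : CMType L} {A : AbelianVariety ℂ} {ι : 𝓞 L →+* End A} {θ : L →+* Module.End ℂ (complexBetti A.X 1)}

/-- **THE HODGE CONJECTURE FOR ALL POWERS OF ALL ABELIAN VARIETIES WITH CM BY A GOOD CYCLOTOMIC FIELD** — gen 18's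
`hodgeConjectureFor_pow_of_isSimple_cyclotomic` WITHOUT the simplicity hypothesis (e.g. `ℚ(ζ_N)` for `N ≤ 24`, `N ≠ 21`;
`ℚ(ζ_p)` with `p − 1 = 2^s q`, `q ∈ {1} ∪ primes`; `ℚ(ζ_9)`, `ℚ(ζ_{25})`, `ℚ(ζ_{289})`). UNCONDITIONAL.
[cite: Gordon1999HodgeAVSurvey, 5.13 (i) and Thm. 6.4] [cite: Kubota1965, §4 Lemma 2] -/
theorem hodgeConjectureFor_pow_of_cyclotomic_good {N a m : ℕ} (hN : 3 ≤ N) (hm : Odd m)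
    (hφ : N.totient = 2 ^ (a + 1) * m) [IsCyclotomicExtension {N} ℚ L]
    (hgood : (m = 1 ∧ N.totient ≤ 8) ∨ (IsCyclic (ZMod N)ˣ ∧ (m = 1 ∨ m.Prime)))
    (hA : IsCMTypeRealisation Φ A ι θ) (M : ℕ) :
    HodgeConjectureFor (⨁ fun _ : Fin M => A).dim (⨁ fun _ : Fin M => A).X := by
  obtain ⟨i, -⟩ := exists_ringHom_endAlgebra ι
  exact hodgeConjectureFor_of_isDivisorGenerated _
    ((isStablyNondegenerate_iff_forall_isDivisorGenerated_biproduct A).1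
      (isStablyNondegenerate_of_cyclotomic_good hN hm hφ hgood i (finrank_eq_two_mul_dim_of_isCMTypeRealisation hA)) M)

/-- **Realisation form of the classification**: every abelian variety `(A, ι)` of ANY CM type of `ℚ(ζ_N)` is stably
nondegenerate ⟺ the cyclotomic condition. [cite: Gordon1999HodgeAVSurvey, Thm. 6.4] [cite: Shimura1998, §8.2 Prop. 26] -/
theorem forall_realisation_isStablyNondegenerate_iff_cyclotomic_all {N a m : ℕ} (hN : 3 ≤ N) (hm : Odd m)
    (hφ : N.totient = 2 ^ (a + 1) * m) [IsCyclotomicExtension {N} ℚ L] :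
    (∀ (Φ : CMType L) (A : AbelianVariety ℂ) (ι : 𝓞 L →+* End A) (θ : L →+* Module.End ℂ (complexBetti A.X 1)),
        IsCMTypeRealisation Φ A ι θ → IsStablyNondegenerate A) ↔
      (m = 1 ∧ N.totient ≤ 8) ∨ (IsCyclic (ZMod N)ˣ ∧ (m = 1 ∨ m.Prime)) := by
  obtain ⟨hcm, hgal, hcomm, -, hL⟩ := cyclotomic_data hN L
  haveI := hcm
  haveI := hgal
  rw [AbelianAllTypes.forall_realisation_isStablyNondegenerate_iff_abelian hcomm hm (hL.trans hφ),
    ← AbelianAllTypes.forall_isStablyNondegenerate_iff_abelian hcomm hm (hL.trans hφ)]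
  exact forall_isStablyNondegenerate_iff_cyclotomic_all hN hm hφ

/-- **HC on the class «isogenous to a power of an abelian variety `X` with an action of a GOOD cyclotomic field
`ℚ(ζ_N)`, `φ(N) = 2 dim X`»** — UNCONDITIONAL, no simplicity. [cite: Gordon1999HodgeAVSurvey, Thm. 6.3–6.4] -/
theorem hcOnClass_isIsogenous_powSucc_cyclotomic_good :
    HCOnClass fun B ↦ ∃ (X : AbelianVariety ℂ) (M : ℕ) (L : Type) (_ : Field L) (_ : NumberField L) (N a m : ℕ)
      (_ : IsCyclotomicExtension {N} ℚ L), 3 ≤ N ∧ Odd m ∧ N.totient = 2 ^ (a + 1) * m ∧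
      ((m = 1 ∧ N.totient ≤ 8) ∨ (IsCyclic (ZMod N)ˣ ∧ (m = 1 ∨ m.Prime))) ∧
      Module.finrank ℚ L = 2 * X.dim ∧ Nonempty (L →+* X.endAlgebra) ∧ IsIsogenous B (X.powSucc M) := by
  rintro B ⟨X, M, L, _, _, N, a, m, _, hN, hm, hφ, hgood, hX, ⟨φ⟩, h⟩
  exact hodgeConjectureFor_of_isIsogenous_powSucc_cyclotomic_good hN hm hφ hgood φ hX h

end Summit.HodgeConjecture.CorCM.CyclotomicAllTypes

end
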